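import Mathlib.GroupTheory.Nilpotent
import Mathlib.GroupTheory.QuotientGroup.Basic
import Literature.Topology.FourManifolds.GroupTrisections
import HarnessLib

/-!
# Johnson generators I: class-2 calculus (helper for stub `stub_johnsonGenerators`)

Line `saturated-torsor-descent`, crux `CongruenceShadows.NilpotentShadowsStandard`
(item stmt-SmoothPoincare4-14594).  General group theory, any group `G`, `Q = G ⧸ γ₃ G` with
`γₖ₊₁ G = (⊤).lowerCentralSeries k`:
* in a group of class `≤ 2` (e.g. `Q`) commutators are central and `⁅·, ·⁆` is bimultiplicative,
  alternating and conjugation invariant;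
* for an IA-automorphism `ψ` (`ψ s · s⁻¹ ∈ γ₂`), `s ↦ ψ s · s⁻¹ (mod γ₃)` is a homomorphism to the
  centre of `Q`, kills `γ₂`, and is additive in `ψ` (inverse, composite, conjugate): the registered
  helper `helper_johnsonTauHom`.
Mathlib only (plus the tree's `SurfaceGroup` in the registered statement); no definitions.
-/

set_option linter.dupNamespace false

open Subgroup Literature.Topology.FourManifolds
open scoped commutatorElement

namespace Summit.SmoothPoincare4.SmoothPoincare4.Theorems.NilpotentShadowsStandard.SaturatedTorsorDescent

/-! ## Groups of nilpotency class at most two -/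

section ClassTwo

variable {M : Type*} [Group M]

/-- In class `≤ 2`, commutators are central. [folklore] -/
theorem c2_comm (hM : ∀ a b c : M, ⁅⁅a, b⁆, c⁆ = 1) (a b c : M) : ⁅a, b⁆ * c = c * ⁅a, b⁆ :=
  commutatorElement_eq_one_iff_mul_comm.1 (hM a b c)

/-- In class `≤ 2`, commutators lie in the centre. [folklore] -/
theorem c2_mem_center (hM : ∀ a b c : M, ⁅⁅a, b⁆, c⁆ = 1) (a b : M) : ⁅a, b⁆ ∈ center M :=
  mem_center_iff.2 fun c => (c2_comm hM a b c).symm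

/-- In class `≤ 2`, `⁅a b, c⁆ = ⁅a, c⁆ ⁅b, c⁆`. [folklore] -/
theorem c2_mul_left (hM : ∀ a b c : M, ⁅⁅a, b⁆, c⁆ = 1) (a b c : M) :
    ⁅a * b, c⁆ = ⁅a, c⁆ * ⁅b, c⁆ := by
  rw [commutatorElement_mul_left_eq_conj_mul, ← c2_comm hM b c a, mul_inv_cancel_right, c2_comm hM b c]

/-- In class `≤ 2`, `⁅a, b c⁆ = ⁅a, b⁆ ⁅a, c⁆`. [folklore] -/
theorem c2_mul_right (hM : ∀ a b c : M, ⁅⁅a, b⁆, c⁆ = 1) (a b c : M) :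
    ⁅a, b * c⁆ = ⁅a, b⁆ * ⁅a, c⁆ := by
  rw [commutatorElement_mul_right_eq_mul_conj, mul_assoc ⁅a, b⁆ b, ← c2_comm hM a c b, ← mul_assoc,
    mul_inv_cancel_right]

/-- In class `≤ 2`, `⁅a⁻¹, b⁆ = ⁅a, b⁆⁻¹`. [folklore] -/
theorem c2_inv_left (hM : ∀ a b c : M, ⁅⁅a, b⁆, c⁆ = 1) (a b : M) : ⁅a⁻¹, b⁆ = ⁅a, b⁆⁻¹ := by
  have h := c2_mul_left hM a⁻¹ a b
  rw [inv_mul_cancel, commutatorElement_one_left] at h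
  exact eq_inv_of_mul_eq_one_left h.symm

/-- In class `≤ 2`, `⁅a, b⁻¹⁆ = ⁅a, b⁆⁻¹`. [folklore] -/
theorem c2_inv_right (hM : ∀ a b c : M, ⁅⁅a, b⁆, c⁆ = 1) (a b : M) : ⁅a, b⁻¹⁆ = ⁅a, b⁆⁻¹ := by
  have h := c2_mul_right hM a b⁻¹ b
  rw [inv_mul_cancel, commutatorElement_one_right] at h
  exact eq_inv_of_mul_eq_one_left h.symm

/-- In class `≤ 2`, `⁅a ^ k, b⁆ = ⁅a, b⁆ ^ k`. [folklore] -/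
theorem c2_zpow_left (hM : ∀ a b c : M, ⁅⁅a, b⁆, c⁆ = 1) (a b : M) (k : ℤ) :
    ⁅a ^ k, b⁆ = ⁅a, b⁆ ^ k := by
  induction k using Int.induction_on with
  | zero => simp
  | succ k ih => rw [zpow_add_one, c2_mul_left hM, ih, zpow_add_one]
  | pred k ih => rw [zpow_sub_one, c2_mul_left hM, ih, c2_inv_left hM, zpow_sub_one]

/-- In class `≤ 2`, `⁅a, b ^ k⁆ = ⁅a, b⁆ ^ k`. [folklore] -/
theorem c2_zpow_right (hM : ∀ a b c : M, ⁅⁅a, b⁆, c⁆ = 1) (a b : M) (k : ℤ) :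
    ⁅a, b ^ k⁆ = ⁅a, b⁆ ^ k := by
  induction k using Int.induction_on with
  | zero => simp
  | succ k ih => rw [zpow_add_one, c2_mul_right hM, ih, zpow_add_one]
  | pred k ih => rw [zpow_sub_one, c2_mul_right hM, ih, c2_inv_right hM, zpow_sub_one]

/-- In class `≤ 2`, `⁅h a h⁻¹, b⁆ = ⁅a, b⁆`. [folklore] -/
theorem c2_conj_left (hM : ∀ a b c : M, ⁅⁅a, b⁆, c⁆ = 1) (h a b : M) :
    ⁅h * a * h⁻¹, b⁆ = ⁅a, b⁆ := by
  rw [c2_mul_left hM, c2_mul_left hM, c2_inv_left hM, c2_comm hM h b, mul_inv_cancel_right]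

/-- In class `≤ 2`, `⁅a, h b h⁻¹⁆ = ⁅a, b⁆`. [folklore] -/
theorem c2_conj_right (hM : ∀ a b c : M, ⁅⁅a, b⁆, c⁆ = 1) (h a b : M) :
    ⁅a, h * b * h⁻¹⁆ = ⁅a, b⁆ := by
  rw [c2_mul_right hM, c2_mul_right hM, c2_inv_right hM, c2_comm hM a h, mul_inv_cancel_right]

/-- In class `≤ 2`, a product of three commutator powers is raised to a power factorwise.
[folklore] -/
theorem c2_triple_zpow (hM : ∀ a b c : M, ⁅⁅a, b⁆, c⁆ = 1) (a b c d e f : M) (p q r k : ℤ) :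
    (⁅a, b⁆ ^ p * ⁅c, d⁆ ^ q * ⁅e, f⁆ ^ r) ^ k = ⁅a, b⁆ ^ (p * k) * ⁅c, d⁆ ^ (q * k) * ⁅e, f⁆ ^ (r * k) := by
  have hab : ∀ (x : M) (m : ℤ), Commute (⁅a, b⁆ ^ m) x := fun x m =>
    ((c2_mem_center hM a b) |> fun h => (mem_center_iff.1 (zpow_mem h m) x).symm)
  have hcd : ∀ (x : M) (m : ℤ), Commute (⁅c, d⁆ ^ m) x := fun x m =>
    ((c2_mem_center hM c d) |> fun h => (mem_center_iff.1 (zpow_mem h m) x).symm)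
  rw [(Commute.mul_left (hab _ p) (hcd _ q)).mul_zpow, (hab _ p).mul_zpow, zpow_mul, zpow_mul, zpow_mul]

/-- In class `≤ 2`, a product of three commutator powers may be rotated. [folklore] -/
theorem c2_rotate3 (hM : ∀ a b c : M, ⁅⁅a, b⁆, c⁆ = 1) (a b c d e f : M) (p q r : ℤ) :
    ⁅a, b⁆ ^ p * ⁅c, d⁆ ^ q * ⁅e, f⁆ ^ r = ⁅c, d⁆ ^ q * ⁅e, f⁆ ^ r * ⁅a, b⁆ ^ p := by
  rw [mul_assoc, (mem_center_iff.1 (zpow_mem (c2_mem_center hM a b) p) _)]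

/-- In class `≤ 2`, the first two of three commutator powers may be swapped. [folklore] -/
theorem c2_swap12 (hM : ∀ a b c : M, ⁅⁅a, b⁆, c⁆ = 1) (a b c d e f : M) (p q r : ℤ) :
    ⁅a, b⁆ ^ p * ⁅c, d⁆ ^ q * ⁅e, f⁆ ^ r = ⁅c, d⁆ ^ q * ⁅a, b⁆ ^ p * ⁅e, f⁆ ^ r := by
  rw [(mem_center_iff.1 (zpow_mem (c2_mem_center hM a b) p) _)]

end ClassTwo

/-! ## The class-two quotient `G ⧸ γ₃ G` -/

section Quotient

variable {G : Type*} [Group G]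

/-- The class of a commutator is the commutator of the classes. [folklore] -/
theorem quot_commutatorElement (N : Subgroup G) [N.Normal] (a b : G) :
    ((⁅a, b⁆ : G) : G ⧸ N) = ⁅(a : G ⧸ N), (b : G ⧸ N)⁆ := by
  rw [← QuotientGroup.mk'_apply, map_commutatorElement, QuotientGroup.mk'_apply, QuotientGroup.mk'_apply]

/-- `G ⧸ γ₃ G` has class `≤ 2`. [folklore] -/
theorem quot_class_two (a b c : G ⧸ (⊤ : Subgroup G).lowerCentralSeries 2) : ⁅⁅a, b⁆, c⁆ = 1 := by
  obtain ⟨a, rfl⟩ := QuotientGroup.mk_surjective a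
  obtain ⟨b, rfl⟩ := QuotientGroup.mk_surjective b
  obtain ⟨c, rfl⟩ := QuotientGroup.mk_surjective c
  rw [← quot_commutatorElement, ← quot_commutatorElement, QuotientGroup.eq_one_iff]
  exact commutator_mem_commutator (commutator_mem_commutator (mem_top a) (mem_top b)) (mem_top c)

/-- Elements of `γ₂` are central modulo `γ₃`. [folklore] -/
theorem quot_central {p : G} (hp : p ∈ (⊤ : Subgroup G).lowerCentralSeries 1)
    (q : G ⧸ (⊤ : Subgroup G).lowerCentralSeries 2) :
    (p : G ⧸ (⊤ : Subgroup G).lowerCentralSeries 2) * q = q * p := by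
  obtain ⟨q, rfl⟩ := QuotientGroup.mk_surjective q
  rw [← commutatorElement_eq_one_iff_mul_comm, ← quot_commutatorElement, QuotientGroup.eq_one_iff]
  exact commutator_mem_commutator hp (mem_top q)

/-- The class of a product of three commutator powers. [folklore] -/
theorem quot_triple (N : Subgroup G) [N.Normal] (a b c d e f : G) (p q r : ℤ) :
    ((⁅a, b⁆ ^ p * ⁅c, d⁆ ^ q * ⁅e, f⁆ ^ r : G) : G ⧸ N) =
      ⁅(a : G ⧸ N), (b : G ⧸ N)⁆ ^ p * ⁅(c : G ⧸ N), (d : G ⧸ N)⁆ ^ q * ⁅(e : G ⧸ N), (f : G ⧸ N)⁆ ^ r := by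
  rw [QuotientGroup.mk_mul, QuotientGroup.mk_mul, QuotientGroup.mk_zpow, QuotientGroup.mk_zpow,
    QuotientGroup.mk_zpow, quot_commutatorElement, quot_commutatorElement, quot_commutatorElement]

/-- `a t⁻¹ ∈ N ↔ a ≡ t` in `G ⧸ N`. [folklore] -/
theorem mul_inv_mem_iff_quot (N : Subgroup G) [N.Normal] (a t : G) :
    a * t⁻¹ ∈ N ↔ (a : G ⧸ N) = t := by
  rw [QuotientGroup.eq_iff_div_mem, div_eq_mul_inv]

/-- Automorphisms preserve `γₖ`. [folklore] -/
theorem equiv_mem_lcs (φ : G ≃* G) {k : ℕ} {x : G} (hx : x ∈ (⊤ : Subgroup G).lowerCentralSeries k) :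
    φ x ∈ (⊤ : Subgroup G).lowerCentralSeries k := by
  have hc := (Subgroup.characteristic_iff_map_eq.1
    (inferInstance : ((⊤ : Subgroup G).lowerCentralSeries k).Characteristic)) φ
  have h1 : φ.toMonoidHom x ∈ ((⊤ : Subgroup G).lowerCentralSeries k).map φ.toMonoidHom :=
    mem_map_of_mem _ hx
  rwa [hc] at h1

/-- Automorphisms act on congruences modulo `γ₃`. [folklore] -/
theorem quot_congr_equiv (φ : G ≃* G) {a b : G}
    (h : (a : G ⧸ (⊤ : Subgroup G).lowerCentralSeries 2) = b) :
    (φ a : G ⧸ (⊤ : Subgroup G).lowerCentralSeries 2) = φ b := by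
  rw [← mul_inv_mem_iff_quot] at h ⊢
  simpa [map_mul, map_inv] using equiv_mem_lcs φ h

end Quotient

/-! ## IA-automorphisms and the Johnson map modulo `γ₃` -/

section IA

variable {G : Type*} [Group G]

/-- IA is closed under inverses. [folklore] -/
theorem ia_symm {ψ : G ≃* G} (hψ : ∀ s, ψ s * s⁻¹ ∈ (⊤ : Subgroup G).lowerCentralSeries 1) (s : G) :
    ψ.symm s * s⁻¹ ∈ (⊤ : Subgroup G).lowerCentralSeries 1 := by
  have h1 := inv_mem (hψ (ψ.symm s))
  rw [MulEquiv.apply_symm_apply] at h1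
  simpa using h1

/-- IA is closed under composition. [folklore] -/
theorem ia_trans {ψ φ : G ≃* G} (hψ : ∀ s, ψ s * s⁻¹ ∈ (⊤ : Subgroup G).lowerCentralSeries 1)
    (hφ : ∀ s, φ s * s⁻¹ ∈ (⊤ : Subgroup G).lowerCentralSeries 1) (s : G) :
    (ψ.trans φ) s * s⁻¹ ∈ (⊤ : Subgroup G).lowerCentralSeries 1 := by
  have e : φ (ψ s) * s⁻¹ = (φ (ψ s) * (ψ s)⁻¹) * (ψ s * s⁻¹) := by group
  rw [MulEquiv.trans_apply, e]
  exact mul_mem (hφ _) (hψ _)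

/-- IA is normal in `Aut G`. [folklore] -/
theorem ia_conj {ψ : G ≃* G} (hψ : ∀ s, ψ s * s⁻¹ ∈ (⊤ : Subgroup G).lowerCentralSeries 1)
    (φ : G ≃* G) (s : G) :
    (φ.symm.trans (ψ.trans φ)) s * s⁻¹ ∈ (⊤ : Subgroup G).lowerCentralSeries 1 := by
  have e : (φ.symm.trans (ψ.trans φ)) s * s⁻¹ = φ (ψ (φ.symm s) * (φ.symm s)⁻¹) := by
    simp [map_mul]
  rw [e]
  exact equiv_mem_lcs φ (hψ _)

/-- The value of a conjugate `φ ψ φ⁻¹` at `x` (exact). [folklore] -/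
theorem conj_tau (ψ φ : G ≃* G) (x : G) :
    (φ.symm.trans (ψ.trans φ)) x * x⁻¹ = φ (ψ (φ.symm x) * (φ.symm x)⁻¹) := by
  simp [map_mul]

/-- The Johnson map of an IA-automorphism takes central values modulo `γ₃`. [folklore] -/
theorem ia_quot_central {ψ : G ≃* G} (hψ : ∀ s, ψ s * s⁻¹ ∈ (⊤ : Subgroup G).lowerCentralSeries 1)
    (s : G) (q : G ⧸ (⊤ : Subgroup G).lowerCentralSeries 2) :
    ((ψ s * s⁻¹ : G) : G ⧸ (⊤ : Subgroup G).lowerCentralSeries 2) * q = q * (ψ s * s⁻¹ : G) :=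
  quot_central (hψ s) q

/-- **The Johnson map is a homomorphism modulo `γ₃`**: `ψ(xy)(xy)⁻¹ ≡ (ψx x⁻¹)(ψy y⁻¹)`. [folklore] -/
theorem ia_quot_mul {ψ : G ≃* G} (hψ : ∀ s, ψ s * s⁻¹ ∈ (⊤ : Subgroup G).lowerCentralSeries 1)
    (x y : G) :
    ((ψ (x * y) * (x * y)⁻¹ : G) : G ⧸ (⊤ : Subgroup G).lowerCentralSeries 2) =
      ((ψ x * x⁻¹ : G) : G ⧸ (⊤ : Subgroup G).lowerCentralSeries 2) * (ψ y * y⁻¹ : G) := by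
  have e : ψ (x * y) * (x * y)⁻¹ = (ψ x * x⁻¹) * (x * (ψ y * y⁻¹) * x⁻¹) := by
    simp only [map_mul]; group
  rw [e, QuotientGroup.mk_mul _ (ψ x * x⁻¹), QuotientGroup.mk_mul _ (x * _), QuotientGroup.mk_mul _ x,
    ← ia_quot_central hψ y, QuotientGroup.mk_inv, mul_inv_cancel_right]

/-- The Johnson map kills `1`. [folklore] -/
theorem ia_quot_one (ψ : G ≃* G) :
    ((ψ 1 * 1⁻¹ : G) : G ⧸ (⊤ : Subgroup G).lowerCentralSeries 2) = 1 := by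
  rw [map_one, inv_one, mul_one, QuotientGroup.mk_one]

/-- The Johnson map on an inverse: `ψ(x⁻¹) x ≡ (ψx x⁻¹)⁻¹`. [folklore] -/
theorem ia_quot_inv {ψ : G ≃* G} (hψ : ∀ s, ψ s * s⁻¹ ∈ (⊤ : Subgroup G).lowerCentralSeries 1)
    (x : G) :
    ((ψ x⁻¹ * x⁻¹⁻¹ : G) : G ⧸ (⊤ : Subgroup G).lowerCentralSeries 2) =
      ((ψ x * x⁻¹ : G) : G ⧸ (⊤ : Subgroup G).lowerCentralSeries 2)⁻¹ := by
  have h := ia_quot_mul hψ x x⁻¹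
  rw [mul_inv_cancel, ia_quot_one] at h
  exact (eq_inv_of_mul_eq_one_right h.symm)

/-- The Johnson map on a power: `ψ(xᵏ) x⁻ᵏ ≡ (ψx x⁻¹)ᵏ`. [folklore] -/
theorem ia_quot_zpow {ψ : G ≃* G} (hψ : ∀ s, ψ s * s⁻¹ ∈ (⊤ : Subgroup G).lowerCentralSeries 1)
    (x : G) (k : ℤ) :
    ((ψ (x ^ k) * (x ^ k)⁻¹ : G) : G ⧸ (⊤ : Subgroup G).lowerCentralSeries 2) =
      ((ψ x * x⁻¹ : G) : G ⧸ (⊤ : Subgroup G).lowerCentralSeries 2) ^ k := by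
  induction k using Int.induction_on with
  | zero => rw [zpow_zero, zpow_zero]; exact ia_quot_one ψ
  | succ k ih => rw [zpow_add_one, ia_quot_mul hψ, ih, zpow_add_one]
  | pred k ih => rw [zpow_sub_one, ia_quot_mul hψ, ih, ia_quot_inv hψ, zpow_sub_one]

/-- The Johnson map is conjugation invariant: `ψ(h x h⁻¹)(h x h⁻¹)⁻¹ ≡ ψx x⁻¹`. [folklore] -/
theorem ia_quot_conj {ψ : G ≃* G} (hψ : ∀ s, ψ s * s⁻¹ ∈ (⊤ : Subgroup G).lowerCentralSeries 1)
    (h x : G) :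
    ((ψ (h * x * h⁻¹) * (h * x * h⁻¹)⁻¹ : G) : G ⧸ (⊤ : Subgroup G).lowerCentralSeries 2) =
      ((ψ x * x⁻¹ : G) : G ⧸ (⊤ : Subgroup G).lowerCentralSeries 2) := by
  rw [ia_quot_mul hψ, ia_quot_mul hψ, ia_quot_inv hψ, ia_quot_central hψ h,
    mul_inv_cancel_right]

/-- **IA-automorphisms act trivially on `γ₂ / γ₃`**: `ψ(l) l⁻¹ ≡ 1` for `l ∈ γ₂`. [folklore] -/
theorem ia_quot_lcs {ψ : G ≃* G} (hψ : ∀ s, ψ s * s⁻¹ ∈ (⊤ : Subgroup G).lowerCentralSeries 1)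
    {l : G} (hl : l ∈ (⊤ : Subgroup G).lowerCentralSeries 1) :
    ((ψ l * l⁻¹ : G) : G ⧸ (⊤ : Subgroup G).lowerCentralSeries 2) = 1 := by
  have key : ∀ p : G, ((ψ p : G) : G ⧸ (⊤ : Subgroup G).lowerCentralSeries 2) =
      ((ψ p * p⁻¹ : G) : G ⧸ (⊤ : Subgroup G).lowerCentralSeries 2) * p := fun p => by
    rw [← QuotientGroup.mk_mul, inv_mul_cancel_right]
  rw [QuotientGroup.mk_mul, QuotientGroup.mk_inv, mul_inv_eq_one]
  have hl' : l ∈ closure {g : G | ∃ p ∈ (⊤ : Subgroup G).lowerCentralSeries 0,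
      ∃ q ∈ (⊤ : Subgroup G), ⁅p, q⁆ = g} := hl
  clear hl
  induction hl' using Subgroup.closure_induction with
  | mem g hg =>
    obtain ⟨p, -, q, -, rfl⟩ := hg
    rw [map_commutatorElement, quot_commutatorElement, quot_commutatorElement, key p, key q,
      c2_mul_left quot_class_two, c2_mul_right quot_class_two, c2_mul_right quot_class_two]
    have h1 : ∀ (s : G) (z : G ⧸ (⊤ : Subgroup G).lowerCentralSeries 2),
        ⁅((ψ s * s⁻¹ : G) : G ⧸ (⊤ : Subgroup G).lowerCentralSeries 2), z⁆ = 1 := fun s z =>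
      commutatorElement_eq_one_iff_mul_comm.2 (ia_quot_central hψ s z)
    have h2 : ∀ (s : G) (z : G ⧸ (⊤ : Subgroup G).lowerCentralSeries 2),
        ⁅z, ((ψ s * s⁻¹ : G) : G ⧸ (⊤ : Subgroup G).lowerCentralSeries 2)⁆ = 1 := fun s z => by
      rw [← commutatorElement_inv, h1, inv_one]
    rw [h1, h1, h2, one_mul, one_mul, one_mul]
  | one => simp
  | mul a b _ _ iha ihb => rw [map_mul, QuotientGroup.mk_mul, QuotientGroup.mk_mul, iha, ihb]
  | inv a _ ih => rw [map_inv, QuotientGroup.mk_inv, QuotientGroup.mk_inv, ih]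

/-- The Johnson map of the inverse automorphism: `ψ⁻¹(x) x⁻¹ ≡ (ψx x⁻¹)⁻¹`. [folklore] -/
theorem ia_quot_symm {ψ : G ≃* G} (hψ : ∀ s, ψ s * s⁻¹ ∈ (⊤ : Subgroup G).lowerCentralSeries 1)
    (x : G) :
    ((ψ.symm x * x⁻¹ : G) : G ⧸ (⊤ : Subgroup G).lowerCentralSeries 2) =
      ((ψ x * x⁻¹ : G) : G ⧸ (⊤ : Subgroup G).lowerCentralSeries 2)⁻¹ := by
  have e1 : ψ.symm x * x⁻¹ = (ψ (ψ.symm x) * (ψ.symm x)⁻¹)⁻¹ := by simp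
  have hy : ψ.symm x = (ψ.symm x * x⁻¹) * x := by simp
  rw [e1, QuotientGroup.mk_inv]
  congr 1
  conv_lhs => rw [hy]
  rw [ia_quot_mul hψ, ia_quot_lcs hψ (ia_symm hψ x), one_mul]

/-- The Johnson map of a composite: `φ(ψ x) x⁻¹ ≡ (φx x⁻¹)(ψx x⁻¹)`. [folklore] -/
theorem ia_quot_trans {ψ φ : G ≃* G} (hψ : ∀ s, ψ s * s⁻¹ ∈ (⊤ : Subgroup G).lowerCentralSeries 1)
    (hφ : ∀ s, φ s * s⁻¹ ∈ (⊤ : Subgroup G).lowerCentralSeries 1) (x : G) :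
    ((φ (ψ x) * x⁻¹ : G) : G ⧸ (⊤ : Subgroup G).lowerCentralSeries 2) =
      ((φ x * x⁻¹ : G) : G ⧸ (⊤ : Subgroup G).lowerCentralSeries 2) * (ψ x * x⁻¹ : G) := by
  have e : φ (ψ x) * x⁻¹ = (φ (ψ x * x⁻¹) * (ψ x * x⁻¹)⁻¹) * ((ψ x * x⁻¹) * (φ x * x⁻¹) * (ψ x * x⁻¹)⁻¹)
      * (ψ x * x⁻¹) := by
    simp only [map_mul, map_inv]; group
  rw [e, QuotientGroup.mk_mul, QuotientGroup.mk_mul, ia_quot_lcs hφ (hψ x), one_mul,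
    QuotientGroup.mk_mul, QuotientGroup.mk_mul, ia_quot_central hψ x, QuotientGroup.mk_inv,
    inv_mul_cancel_right, ← ia_quot_central hψ x]

end IA


/-- **Registered helper**: the first Johnson map `ψ ↦ (x ↦ ψ(x) x⁻¹ mod γ₃)` is additive on IA-automorphisms of `S_g` (`(φ ψ)(x) x⁻¹ ≡ (φ x x⁻¹)(ψ x x⁻¹)`). [folklore] -/
theorem helper_johnsonTauHom : ∀ (g : ℕ) (ψ φ : Literature.Topology.FourManifolds.SurfaceGroup g ≃* Literature.Topology.FourManifolds.SurfaceGroup g), (∀ s : Literature.Topology.FourManifolds.SurfaceGroup g, ψ s * s⁻¹ ∈ (⊤ : Subgroup (Literature.Topology.FourManifolds.SurfaceGroup g)).lowerCentralSeries 1) → (∀ s : Literature.Topology.FourManifolds.SurfaceGroup g, φ s * s⁻¹ ∈ (⊤ : Subgroup (Literature.Topology.FourManifolds.SurfaceGroup g)).lowerCentralSeries 1) → ∀ x : Literature.Topology.FourManifolds.SurfaceGroup g, φ (ψ x) * x⁻¹ * ((φ x * x⁻¹) * (ψ x * x⁻¹))⁻¹ ∈ (⊤ : Subgroup (Literature.Topology.FourManifolds.SurfaceGroup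 g)).lowerCentralSeries 2 := by
  intro g ψ φ hψ hφ x
  rw [mul_inv_mem_iff_quot, QuotientGroup.mk_mul]
  exact ia_quot_trans hψ hφ x

end Summit.SmoothPoincare4.SmoothPoincare4.Theorems.NilpotentShadowsStandard.SaturatedTorsorDescent
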